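import Summits.CriticalPhenomena.PercolationContinuityZ3.Theorems.PercNearOneGluingNoHeavyLowerTailSahiSlotPinnedCert
import Summits.CriticalPhenomena.PercolationContinuityZ3.Theorems.PercNearOneGluingNoHeavyLowerTailSahiSlotPointEval
import Summits.CriticalPhenomena.PercolationContinuityZ3.Theorems.PercNearOneGluingNoHeavyLowerTailSahiSlotPatternThree
import Summits.CriticalPhenomena.PercolationContinuityZ3.Theorems.PercNearOneGluingNoHeavyLowerTailSahiGridPatternZeroLocusIndep

/-!
# The PINNED PAIR CONE at order 3: a calculus of `C ⊗ C` certificates for one pinned up-set `A` (every dimension `d`)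

Support file of the one-cut programme (crux `NoHeavyLowerTail`, stmt-CriticalPhenomena-4575; cell `prim-masterthm`, seat P3, gen 23;
`run/shared/lean/prim/prim-masterthm/prim-masterthm-p3/HIERARCHY.md` §31, memo `FROM-prim-masterthm-p3-g23-FORMAT-LIFTS.md`).

CONTEXT.  The pinned / pivotal-pair certificate format of gens 21–22 (`SahiSlot.PinnedLitCert d 2`): for every up-set `A` of the slot
cube `[3]^d` the bilinear functional `(B, C) ↦ patternForm d 3 (1_A, 1_B, 1_C)` (`=` prim-sahi's `sStarD A B C`,
`patternForm_three_setInd`) is a NONNEGATIVE combination of products `ℓ(1_B)·ℓ'(1_C)` of monotonicity literals (`SahiSlot.Lit`).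
This file sets up the bookkeeping that lets such certificates be ASSEMBLED uniformly in `d`:
* `SahiSlot.InCone d φ` — the single cone: `φ(B) = Σ c_i ℓ_i(1_B)` on up-sets, `c_i ≥ 0`; `SahiSlot.InPairCone d F` — the pair cone:
  `F(B,C) = Σ c_i ℓ_i(1_B) ℓ'_i(1_C)`; both indexed by an arbitrary `Fintype` (closure under sums is then painless);
* closure: `add`, `smul`, `sum`, `InPairCone.mul` (`φ ⊗ ψ`), `congr`; soundness `InPairCone.nonneg`;
* generators: literals, POINT EVALUATIONS `B ↦ 1_B(p)` (`InCone.point`, from `exists_path_lits`), and single-coordinate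
  increments `B ↦ 1_B(p[a ↦ v]) − 1_B(p[a ↦ u])`, `u ≤ v` (`InCone.incr`);
* `SahiSlot.PinnedGood d A :⟺ InPairCone d (sStarD A · ·)`; **`pinnedLitCert_two_of_forall_pinnedGood`**:
  `(∀ A up-set, PinnedGood d A) → PinnedLitCert d 2`, and `PinnedGood.sStarD_nonneg` (a pinned certificate makes `A` a good first slot);
* the two extreme instances in every dimension: `pinnedGood_empty`, **`pinnedGood_univ`** (`A = ⊤`: the form is the Harris slack
  `harrisSlack`, certified by gen 22's `harrisSlack_eq_sum_litPairs`; identification `sStarD_univ_eq_harrisSlack` of prim-sahi-p1).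
The companion file `…SahiSlotPairConeLifts` proves that `PinnedGood` is closed under the two instance-blind lifts `A ↦ A × {2}`,
`A ↦ A × {1,2}` of prim-sahi-p1's orthant induction (there at the VALUE level), hence holds for every orthant in every dimension.
HONEST LABEL: certificate-format bookkeeping; no open cell changes status.  Pure, standard axioms. [this work]
-/

noncomputable section

namespace Summit.CriticalPhenomena.PercolationContinuityZ3.Theorems

open Finset Function
open Literature.Combinatorics.Sahi2008

namespace SahiSlot

open SahiGridPattern SahiGrid3

variable {d : ℕ}

/-! ### The two cones -/

/-- **The single cone**: `φ(B)` is, on up-sets `B`, a fixed nonnegative combination of literal values `ℓ(1_B)`. [this work] [status: certificate-format bookkeeping, not an obligation] -/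
def InCone (d : ℕ) (φ : Finset (Q d 3) → ℝ) : Prop :=
  ∃ (ι : Type) (_ : Fintype ι) (c : ι → ℝ) (J : ι → Lit d 3), (∀ i, 0 ≤ c i) ∧
    ∀ B : Finset (Q d 3), IsUpperSet ((B : Finset (Q d 3)) : Set (Q d 3)) → φ B = ∑ i, c i * (J i).eval (setInd B)

/-- **The pair cone** `C ⊗ C`: `F(B,C)` is, on pairs of up-sets, a fixed nonnegative combination of products `ℓ(1_B)·ℓ'(1_C)`. [this work] [status: certificate-format bookkeeping, not an obligation] -/
def InPairCone (d : ℕ) (F : Finset (Q d 3) → Finset (Q d 3) → ℝ) : Prop :=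
  ∃ (ι : Type) (_ : Fintype ι) (c : ι → ℝ) (J J' : ι → Lit d 3), (∀ i, 0 ≤ c i) ∧
    ∀ B C : Finset (Q d 3), IsUpperSet ((B : Finset (Q d 3)) : Set (Q d 3)) → IsUpperSet ((C : Finset (Q d 3)) : Set (Q d 3)) →
      F B C = ∑ i, c i * ((J i).eval (setInd B) * (J' i).eval (setInd C))

/-! ### Closure properties of the single cone -/

/-- Agreement on up-sets suffices. [this work] -/
theorem InCone.congr {φ ψ : Finset (Q d 3) → ℝ} (h : InCone d φ)
    (he : ∀ B : Finset (Q d 3), IsUpperSet ((B : Finset (Q d 3)) : Set (Q d 3)) → ψ B = φ B) : InCone d ψ := by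
  obtain ⟨ι, hι, c, J, hc, hid⟩ := h
  exact ⟨ι, hι, c, J, hc, fun B hB => by rw [he B hB, hid B hB]⟩

/-- Zero is in the cone. [this work] -/
theorem InCone.zero : InCone d (fun _ => 0) :=
  ⟨PEmpty, inferInstance, fun _ => 0, fun i => i.elim, fun i => i.elim, fun B _ => by simp⟩

/-- A literal is in the cone. [this work] -/
theorem InCone.lit (ℓ : Lit d 3) : InCone d (fun B => ℓ.eval (setInd B)) :=
  ⟨Unit, inferInstance, fun _ => 1, fun _ => ℓ, fun _ => zero_le_one, fun B _ => by simp⟩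

/-- Sums. [this work] -/
theorem InCone.add {φ ψ : Finset (Q d 3) → ℝ} (hφ : InCone d φ) (hψ : InCone d ψ) : InCone d (fun B => φ B + ψ B) := by
  obtain ⟨ι, hι, c, J, hc, hid⟩ := hφ
  obtain ⟨ι', hι', c', J', hc', hid'⟩ := hψ
  refine ⟨ι ⊕ ι', inferInstance, Sum.elim c c', Sum.elim J J', fun i => ?_, fun B hB => ?_⟩
  · cases i with
    | inl i => exact hc i
    | inr i => exact hc' i
  · dsimp only
    rw [hid B hB, hid' B hB, Fintype.sum_sum_type]
    simp only [Sum.elim_inl, Sum.elim_inr]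

/-- Nonnegative multiples. [this work] -/
theorem InCone.smul {φ : Finset (Q d 3) → ℝ} (hφ : InCone d φ) {a : ℝ} (ha : 0 ≤ a) : InCone d (fun B => a * φ B) := by
  obtain ⟨ι, hι, c, J, hc, hid⟩ := hφ
  refine ⟨ι, hι, fun i => a * c i, J, fun i => mul_nonneg ha (hc i), fun B hB => ?_⟩
  dsimp only
  rw [hid B hB, mul_sum]
  exact sum_congr rfl fun i _ => by ring

/-- Finite sums. [this work] -/
theorem InCone.sum {σ : Type*} (s : Finset σ) {φ : σ → Finset (Q d 3) → ℝ} (h : ∀ x ∈ s, InCone d (φ x)) :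
    InCone d (fun B => ∑ x ∈ s, φ x B) := by
  classical
  induction s using Finset.induction_on with
  | empty => exact InCone.zero.congr fun B _ => by simp
  | @insert x s hx ih =>
    have h1 : InCone d (φ x) := h x (mem_insert_self x s)
    have h2 : InCone d (fun B => ∑ y ∈ s, φ y B) := ih fun y hy => h y (mem_insert_of_mem hy)
    exact (h1.add h2).congr fun B _ => by rw [sum_insert hx]

/-- Finite sums with nonnegative weights. [this work] -/
theorem InCone.sum_smul {σ : Type*} (s : Finset σ) {w : σ → ℝ} (hw : ∀ x ∈ s, 0 ≤ w x) {φ : σ → Finset (Q d 3) → ℝ}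
    (h : ∀ x ∈ s, InCone d (φ x)) : InCone d (fun B => ∑ x ∈ s, w x * φ x B) :=
  InCone.sum s fun x hx => (h x hx).smul (hw x hx)

/-- Values of cone functionals on up-sets are nonnegative. [this work] -/
theorem InCone.nonneg {φ : Finset (Q d 3) → ℝ} (hφ : InCone d φ) (B : Finset (Q d 3))
    (hB : IsUpperSet ((B : Finset (Q d 3)) : Set (Q d 3))) : 0 ≤ φ B := by
  obtain ⟨ι, hι, c, J, hc, hid⟩ := hφ
  rw [hid B hB]
  exact sum_nonneg fun i _ => mul_nonneg (hc i) (Lit.eval_setInd_nonneg B hB _)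

/-! ### Generators of the single cone: the bottom point, cut edges, points, single-coordinate increments -/

/-- The value of the indicator at the bottom point is the `bot` literal. [this work] -/
theorem eval_bot_setInd (B : Finset (Q d 3)) : (Lit.bot : Lit d 3).eval (setInd B) = setInd B (fun _ => 0) := by
  show (if h : 0 < 3 then setInd B (fun _ => ⟨0, h⟩) else 0) = setInd B (fun _ => 0)
  rw [dif_pos (by norm_num)]
  rfl

/-- **Point evaluations are in the cone**: `B ↦ 1_B(p)` (`x_⊥` plus a path of cut edges, `exists_path_lits`). [this work] -/
theorem InCone.point (p : Q d 3) : InCone d (fun B => setInd B p) := by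
  obtain ⟨k, c, J, hc, hid⟩ := exists_path_lits d p
  have h1 : InCone d (fun B => ∑ t, c t * (J t).eval (setInd B)) :=
    (InCone.sum_smul univ (fun t _ => hc t) fun t _ => InCone.lit (J t)).congr fun B _ => rfl
  exact ((InCone.lit Lit.bot).add h1).congr fun B _ => by rw [eval_bot_setInd, ← hid (setInd B)]; ring

/-- A genuine cut edge as an indicator difference. [this work] -/
theorem eval_cover_setInd (B : Finset (Q d 3)) (p : Q d 3) (a : Fin d) (h : (p a : ℕ) + 1 < 3) :
    (Lit.cover p a : Lit d 3).eval (setInd B) = setInd B (update p a ⟨(p a : ℕ) + 1, h⟩) - setInd B p := by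
  show (if h' : (p a : ℕ) + 1 < 3 then setInd B (update p a ⟨(p a : ℕ) + 1, h'⟩) - setInd B p else 0) = _
  rw [dif_pos h]

/-- One step up in coordinate `a`: `B ↦ 1_B(p[a ↦ u+1]) − 1_B(p[a ↦ u])` is in the cone (it is a cut edge). [this work] -/
theorem InCone.step (p : Q d 3) (a : Fin d) (u : Fin 3) (hu : (u : ℕ) + 1 < 3) :
    InCone d (fun B => setInd B (update p a ⟨(u : ℕ) + 1, hu⟩) - setInd B (update p a u)) := by
  have hpa : ((update p a u) a : ℕ) + 1 < 3 := by rw [update_self]; exact hu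
  refine (InCone.lit (Lit.cover (update p a u) a)).congr fun B _ => ?_
  rw [eval_cover_setInd B _ a hpa]
  have hX : (⟨((update p a u) a : ℕ) + 1, hpa⟩ : Fin 3) = ⟨(u : ℕ) + 1, hu⟩ := Fin.ext (by simp only [update_self])
  rw [hX, update_idem]

/-- **Single-coordinate increments are in the cone**: `B ↦ 1_B(p[a ↦ v]) − 1_B(p[a ↦ u])` for `u ≤ v`. [this work] -/
theorem InCone.incr (p : Q d 3) (a : Fin d) {u v : Fin 3} (huv : u ≤ v) :
    InCone d (fun B => setInd B (update p a v) - setInd B (update p a u)) := by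
  have h01 : InCone d (fun B => setInd B (update p a 1) - setInd B (update p a 0)) := InCone.step p a 0 (by decide)
  have h12 : InCone d (fun B => setInd B (update p a 2) - setInd B (update p a 1)) := InCone.step p a 1 (by decide)
  have h02 : InCone d (fun B => setInd B (update p a 2) - setInd B (update p a 0)) :=
    (h01.add h12).congr fun B _ => by ring
  have hzero : ∀ w : Fin 3, InCone d (fun B => setInd B (update p a w) - setInd B (update p a w)) :=
    fun w => InCone.zero.congr fun B _ => sub_self _
  obtain ⟨u, hu⟩ := u
  obtain ⟨v, hv⟩ := v
  have huv' : u ≤ v := huv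
  interval_cases u <;> interval_cases v
  · exact hzero ⟨0, hu⟩
  · exact h01
  · exact h02
  · exact hzero ⟨1, hu⟩
  · exact h12
  · exact hzero ⟨2, hu⟩

/-! ### Closure properties of the pair cone -/

/-- Agreement on pairs of up-sets suffices. [this work] -/
theorem InPairCone.congr {F G : Finset (Q d 3) → Finset (Q d 3) → ℝ} (h : InPairCone d F)
    (he : ∀ B C : Finset (Q d 3), IsUpperSet ((B : Finset (Q d 3)) : Set (Q d 3)) → IsUpperSet ((C : Finset (Q d 3)) : Set (Q d 3)) →
      G B C = F B C) : InPairCone d G := by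
  obtain ⟨ι, hι, c, J, J', hc, hid⟩ := h
  exact ⟨ι, hι, c, J, J', hc, fun B C hB hC => by rw [he B C hB hC, hid B C hB hC]⟩

/-- Zero. [this work] -/
theorem InPairCone.zero : InPairCone d (fun _ _ => 0) :=
  ⟨PEmpty, inferInstance, fun _ => 0, fun i => i.elim, fun i => i.elim, fun i => i.elim, fun B C _ _ => by simp⟩

/-- Sums. [this work] -/
theorem InPairCone.add {F G : Finset (Q d 3) → Finset (Q d 3) → ℝ} (hF : InPairCone d F) (hG : InPairCone d G) :
    InPairCone d (fun B C => F B C + G B C) := by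
  obtain ⟨ι, hι, c, J, J', hc, hid⟩ := hF
  obtain ⟨κ, hκ, e, K, K', he, hid'⟩ := hG
  refine ⟨ι ⊕ κ, inferInstance, Sum.elim c e, Sum.elim J K, Sum.elim J' K', fun i => ?_, fun B C hB hC => ?_⟩
  · cases i with
    | inl i => exact hc i
    | inr i => exact he i
  · dsimp only
    rw [hid B C hB hC, hid' B C hB hC, Fintype.sum_sum_type]
    simp only [Sum.elim_inl, Sum.elim_inr]

/-- Nonnegative multiples. [this work] -/
theorem InPairCone.smul {F : Finset (Q d 3) → Finset (Q d 3) → ℝ} (hF : InPairCone d F) {a : ℝ} (ha : 0 ≤ a) :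
    InPairCone d (fun B C => a * F B C) := by
  obtain ⟨ι, hι, c, J, J', hc, hid⟩ := hF
  refine ⟨ι, hι, fun i => a * c i, J, J', fun i => mul_nonneg ha (hc i), fun B C hB hC => ?_⟩
  dsimp only
  rw [hid B C hB hC, mul_sum]
  exact sum_congr rfl fun i _ => by ring

/-- Finite sums. [this work] -/
theorem InPairCone.sum {σ : Type*} (s : Finset σ) {F : σ → Finset (Q d 3) → Finset (Q d 3) → ℝ}
    (h : ∀ x ∈ s, InPairCone d (F x)) : InPairCone d (fun B C => ∑ x ∈ s, F x B C) := by
  classical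
  induction s using Finset.induction_on with
  | empty => exact InPairCone.zero.congr fun B C _ _ => by simp
  | @insert x s hx ih =>
    have h1 : InPairCone d (F x) := h x (mem_insert_self x s)
    have h2 : InPairCone d (fun B C => ∑ y ∈ s, F y B C) := ih fun y hy => h y (mem_insert_of_mem hy)
    exact (h1.add h2).congr fun B C _ _ => by rw [sum_insert hx]

/-- Finite sums with nonnegative weights. [this work] -/
theorem InPairCone.sum_smul {σ : Type*} (s : Finset σ) {w : σ → ℝ} (hw : ∀ x ∈ s, 0 ≤ w x)
    {F : σ → Finset (Q d 3) → Finset (Q d 3) → ℝ} (h : ∀ x ∈ s, InPairCone d (F x)) :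
    InPairCone d (fun B C => ∑ x ∈ s, w x * F x B C) :=
  InPairCone.sum s fun x hx => (h x hx).smul (hw x hx)

/-- **Products** `φ ⊗ ψ` of single-cone functionals are in the pair cone. [this work] -/
theorem InPairCone.mul {φ ψ : Finset (Q d 3) → ℝ} (hφ : InCone d φ) (hψ : InCone d ψ) :
    InPairCone d (fun B C => φ B * ψ C) := by
  obtain ⟨ι, hι, c, J, hc, hid⟩ := hφ
  obtain ⟨κ, hκ, e, K, he, hid'⟩ := hψ
  refine ⟨ι × κ, inferInstance, fun i => c i.1 * e i.2, fun i => J i.1, fun i => K i.2,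
    fun i => mul_nonneg (hc i.1) (he i.2), fun B C hB hC => ?_⟩
  dsimp only
  rw [hid B hB, hid' C hC, sum_mul_sum, ← univ_product_univ, sum_product]
  exact sum_congr rfl fun i _ => sum_congr rfl fun j _ => by ring

/-- **Soundness**: pair-cone functionals are nonnegative on pairs of up-sets. [this work] -/
theorem InPairCone.nonneg {F : Finset (Q d 3) → Finset (Q d 3) → ℝ} (hF : InPairCone d F) (B C : Finset (Q d 3))
    (hB : IsUpperSet ((B : Finset (Q d 3)) : Set (Q d 3))) (hC : IsUpperSet ((C : Finset (Q d 3)) : Set (Q d 3))) : 0 ≤ F B C := by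
  obtain ⟨ι, hι, c, J, J', hc, hid⟩ := hF
  rw [hid B C hB hC]
  exact sum_nonneg fun i _ => mul_nonneg (hc i) (mul_nonneg (Lit.eval_setInd_nonneg B hB _) (Lit.eval_setInd_nonneg C hC _))

/-! ### Pinned up-sets -/

/-- **`PinnedGood d A`**: the up-set `A ⊆ [3]^d` has a PINNED (pivotal-pair) certificate — the bilinear functional
`(B, C) ↦ sStarD A B C` is in the pair cone. [this work] [status: proved here for `A = ∅, ⊤` in every `d`; lifts in `…PairConeLifts`] -/
def PinnedGood (d : ℕ) (A : Finset (Q d 3)) : Prop := InPairCone d (fun B C => (sStarD A B C : ℝ))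

/-- A pinned certificate makes `A` a good first slot of the pattern functional (VALUE level). [this work] -/
theorem PinnedGood.sStarD_nonneg {A : Finset (Q d 3)} (h : PinnedGood d A) (B C : Finset (Q d 3))
    (hB : IsUpperSet ((B : Finset (Q d 3)) : Set (Q d 3))) (hC : IsUpperSet ((C : Finset (Q d 3)) : Set (Q d 3))) : 0 ≤ sStarD A B C := by
  have := h.nonneg B C hB hC
  exact_mod_cast this

/-- **Pinned certificates for all up-sets give `PinnedLitCert d 2`** (the gen-21 format, order 3). [this work] -/
theorem pinnedLitCert_two_of_forall_pinnedGood
    (h : ∀ A : Finset (Q d 3), IsUpperSet ((A : Finset (Q d 3)) : Set (Q d 3)) → PinnedGood d A) : PinnedLitCert d 2 := by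
  intro A hA
  obtain ⟨ι, hι, c, J, J', hc, hid⟩ := h A hA
  let e := Fintype.equivFin ι
  refine ⟨Fintype.card ι, fun j => c (e.symm j), fun j => ![J (e.symm j), J' (e.symm j)],
    fun j => hc _, fun U hU => ?_⟩
  have hfam : (Fin.cons (setInd A) (fun i => setInd (U i)) : Fin 3 → Q d 3 → ℝ) = fun i => setInd ((Fin.cons A U : Fin 3 → Finset (Q d 3)) i) := by
    funext i
    refine Fin.cases ?_ (fun j => ?_) i
    · rw [Fin.cons_zero, Fin.cons_zero]
    · rw [Fin.cons_succ, Fin.cons_succ]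
  rw [hfam, patternForm_three_setInd]
  simp only [Fin.cons_zero]
  have h1 : ((Fin.cons A U : Fin 3 → Finset (Q d 3)) 1) = U 0 := rfl
  have h2 : ((Fin.cons A U : Fin 3 → Finset (Q d 3)) 2) = U 1 := rfl
  have hid' := hid (U 0) (U 1) (hU 0) (hU 1)
  dsimp only at hid'
  rw [h1, h2, hid']
  rw [← e.symm.sum_comp]
  refine sum_congr rfl fun j _ => ?_
  rw [Fin.prod_univ_two]
  rfl

/-- Conversely a `PinnedLitCert d 2` certificate pins every up-set. [this work] -/
theorem PinnedGood.of_pinnedLitCert (h : PinnedLitCert d 2) {A : Finset (Q d 3)}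
    (hA : IsUpperSet ((A : Finset (Q d 3)) : Set (Q d 3))) : PinnedGood d A := by
  obtain ⟨k, coef, J, hcoef, hid⟩ := h A hA
  refine ⟨Fin k, inferInstance, coef, fun j => J j 0, fun j => J j 1, hcoef, fun B C hB hC => ?_⟩
  dsimp only
  have hU : ∀ i, IsUpperSet (((![B, C] : Fin 2 → Finset (Q d 3)) i : Finset (Q d 3)) : Set (Q d 3)) := by
    intro i; fin_cases i
    · exact hB
    · exact hC
  have e := hid ![B, C] hU
  have hfam : (Fin.cons (setInd A) (fun i => setInd ((![B, C] : Fin 2 → Finset (Q d 3)) i)) : Fin 3 → Q d 3 → ℝ) =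
      fun i => setInd ((![A, B, C] : Fin 3 → Finset (Q d 3)) i) := by
    funext i
    refine Fin.cases ?_ (fun j => ?_) i
    · rfl
    · rw [Fin.cons_succ]; fin_cases j <;> rfl
  rw [hfam, patternForm_three_setInd] at e
  have e' : (sStarD A B C : ℝ) = ∑ j, coef j * ∏ i, (J j i).eval (setInd ((![B, C] : Fin 2 → Finset (Q d 3)) i)) := e
  rw [e']
  refine sum_congr rfl fun j _ => ?_
  rw [Fin.prod_univ_two]
  rfl

/-! ### The two extreme pinned sets in every dimension -/

/-- `A = ∅` is (trivially) pinned-good. [this work] -/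
theorem pinnedGood_empty (d : ℕ) : PinnedGood d ∅ :=
  InPairCone.zero.congr fun B C _ _ => by
    rw [sStarD_eq_sum_ind]
    simp [SahiGrid3.ind]

/-- The `ℤ`-indicator of prim-sahi is the real indicator. [this work] -/
theorem cast_ind (S : Finset (Q d 3)) (y : Q d 3) : ((SahiGrid3.ind S y : ℤ) : ℝ) = setInd S y := (setInd_eq_cast_ind S y).symm

/-- `sStarD ⊤ B C` is the coefficientwise Harris slack `harrisSlack d 1_B 1_C` (prim-sahi-p1's `sStarD_univ_eq_harrisSlack`, recast). [this work] -/
theorem cast_sStarD_univ (B C : Finset (Q d 3)) : (sStarD (univ : Finset (Q d 3)) B C : ℝ) = harrisSlack d (setInd B) (setInd C) := by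
  rw [sStarD_swap12, sStarD_swap23, sStarD_univ_eq_harrisSlack]
  unfold harrisSlack
  push_cast
  simp only [cast_ind]
  congr 1
  refine sum_congr rfl fun x _ => sum_congr rfl fun x' _ => ?_
  unfold TotDist
  by_cases h : ∀ a, x a ≠ x' a
  · rw [if_pos h, if_pos (decide_eq_true h), mul_one]
  · rw [if_neg h, if_neg (by simpa using h), mul_zero]

/-- **`A = ⊤` is pinned-good in every dimension** (gen 22's Harris-slack certificate `harrisSlack_eq_sum_litPairs`). [this work] -/
theorem pinnedGood_univ (d : ℕ) : PinnedGood d univ := by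
  obtain ⟨k, c, J, J', hc, hid⟩ := harrisSlack_eq_sum_litPairs d
  exact ⟨Fin k, inferInstance, c, J, J', hc, fun B C _ _ => by (try dsimp only); rw [cast_sStarD_univ, hid]⟩

end SahiSlot

end Summit.CriticalPhenomena.PercolationContinuityZ3.Theorems
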